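import Literature.NumberTheory.EllipticCurves.FormalGroupQuasiPeriodMulDefect
import Literature.NumberTheory.EllipticCurves.FormalGroupMultiplicationPrimeDecompositionInt
import Literature.NumberTheory.EllipticCurves.FormalMulTwoLowOrderProofs
import HarnessLib

/-!
# The multiplication defect modulo `p`: `R_p ≡ −g_{p−1}·X^p (mod p, X^{p+1})` for every integral
# Weierstrass equation and every prime `p` (proofs only)

`Proofs`-style file (THEOREMS ONLY: no definition, no named fact, no instance), topic
`NumberTheory/EllipticCurves`; sequel of `FormalGroupQuasiPeriodMulDefect` (the multiplication defect
`R_n = η₀([n]X) − n·η₀(X)` of the quasi-period function `η₀ = ∫ g_W`, `g_W = formalQuasiPeriodIntegrand`,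
integral by `exists_map_eq_formalQuasiPeriodMulDefect`) and of `FormalGroupMultiplicationPrimeDecompositionInt`
(`p ∣ [Tᵏ][p]` for `p ∤ k`, Silverman AEC IV.4.4).

For `W/ℤ`, a prime `p` and ANY integral lift `Rn ∈ ℤ⟦X⟧` of `R_p(W ⊗ ℚ)` we prove the **η-Hasse congruence**

* `prime_dvd_coeff_of_map_eq_formalQuasiPeriodMulDefect` — `p ∣ [Xʲ]Rn` for all `j < p`;
* `prime_dvd_coeff_prime_add_coeff_formalQuasiPeriodIntegrand` — `p ∣ [X^p]Rn + [X^{p−1}]g_W`,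

i.e. `R_p ≡ −g_{p−1}·X^p (mod p, X^{p+1})` with `g_{p−1} = [z^{p+1}](z²x(z)·ω(z)/dz)` the coefficient of
`z^{p−1}dz` in the differential of the second kind `x ω` (the "η-Hasse invariant" of `W` modulo `p`; for short
models `2a₆` at `p = 5`, `3a₄²` at `p = 7`). STRUCTURAL proof, no symbolic expansion of `[p]`: differentiate
`R_p = η₀([p]X) − pη₀(X)` (chain rule, Mathlib `PowerSeries.derivative_subst`) to get the INTEGRAL identity
`R_p' = g_W([p]X)·[p]'(X) − p·g_W(X)` (`derivative_eq_of_map_eq_formalQuasiPeriodMulDefect`); modulo `p`,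
`[p]' ≡ 0` (AEC IV.4.4) so `R_p' ≡ 0`, giving `p ∣ j·[Xʲ]R_p`, whence the first claim for `0 < j < p`
(`[X⁰]R_p = 0`); and `[p]' = p·D`, `g_W([p]X) ≡ g_W(0) = 0 (mod p, X^p)` (`[p] ≡ 0 (mod p, X^p)`,
`coeff_two_formalXMulSq_mul_formalInvDiff`: `x ω` has no `z⁰dz`-term) give `[X^{p−1}](g_W([p])·[p]') ∈ p²ℤ`,
so `p·[X^p]R_p ≡ −p·g_{p−1} (mod p²)`.

Consumed by `Literature/NumberTheory/PAdicHodge/AinfWeierstrassEtaHasseCriterion` (hypotheses `hlow`, `htop` of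
`mulDefectC_not_mem_span_of_etaHasse`, the transversality `∫_t η ∉ Fil¹B_dR⁺` of the η-period; BSD crux K★
`stmt-BirchSwinnertonDyer-22226`, hDR at potentially supersingular primes). BSD is not proved by any of this.

## References
* N. M. Katz, *Crystalline cohomology, Dieudonné modules, and Jacobi sums* (1981), §5.1–5.2. [Katz1981CrystallineDieudonne]
* P. Colmez, *Périodes p-adiques des variétés abéliennes*, Math. Ann. 292 (1992), §2. [Colmez1992PeriodesAbeliennes]
* J. H. Silverman, *The Arithmetic of Elliptic Curves*, 2nd ed. (2009), IV.1, IV.4.4. [SilvermanAEC2009]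
-/

noncomputable section

open PowerSeries Literature.NumberTheory.EllipticCurves

namespace WeierstrassCurve

/-! ### `x ω` has no `z⁰ dz` term: `[z²]X = −a₂`, `[z²](X·ω) = 0`, `g_W(0) = 0` -/

section AnyRing

variable {R : Type*} [CommRing R] (W : WeierstrassCurve R)

/-- `[z²] X = −a₂` for `X = z²x(z) = 1 − a₁z − a₂z² − ⋯`. [cite: SilvermanAEC2009, IV.1.1] -/
theorem coeff_two_formalXMulSq : coeff 2 W.formalXMulSq = -W.a₂ := by
  have h0 : constantCoeff W.formalXMulSq = 1 := W.constantCoeff_formalXMulSq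
  have h1 : coeff 1 W.formalXMulSq = -W.a₁ := W.coeff_one_formalXMulSq
  have hw0 : constantCoeff W.formalW = 0 := W.constantCoeff_formalW
  have hw1 : coeff 1 W.formalW = 0 := W.coeff_formalW_of_lt_three (by norm_num)
  have hX2 : coeff 1 ((X : R⟦X⟧) ^ 2) = 0 := by rw [coeff_X_pow, if_neg (by norm_num)]
  have hX3 : coeff 1 ((X : R⟦X⟧) ^ 3) = 0 := by rw [coeff_X_pow, if_neg (by norm_num)]
  have e : W.formalXMulSq = W.formalXMulSq * W.formalXMulSq + X * (C W.a₁ * W.formalXMulSq +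
      C W.a₂ * X * W.formalXMulSq + C W.a₃ * X ^ 2 + C W.a₄ * X ^ 3 + C W.a₆ * X ^ 2 * W.formalW) := by
    linear_combination W.formalXMulSq_fixedPoint
  have h := congrArg (coeff (1 + 1)) e
  rw [map_add, coeff_succ_X_mul, coeff_mul, Finset.Nat.sum_antidiagonal_eq_sum_range_succ_mk,
    Finset.sum_range_succ, Finset.sum_range_succ, Finset.sum_range_succ, Finset.sum_range_zero] at h
  simp only [zero_add, Nat.reduceAdd, Nat.sub_self, Nat.add_one_sub_one, coeff_zero_eq_constantCoeff, h0, h1,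
    map_add, map_mul, coeff_C_mul, PowerSeries.coeff_one_mul, coeff_one_X, mul_one,
    one_mul, show (2 : ℕ) - 0 = 2 from rfl, constantCoeff_C, constantCoeff_X, map_pow, hw0, hw1, hX2, hX3,
    mul_zero, zero_mul, add_zero] at h
  linear_combination -h

/-- **`x ω` has no `z⁰ dz`-term**: `[z²](X·ω) = (a₁² + a₂) − a₁·a₁ − a₂ = 0`
(`X = 1 − a₁z − a₂z² − ⋯`, `ω = (1 + a₁z + (a₁² + a₂)z² + ⋯)dz`). [cite: SilvermanAEC2009, IV.1.1] -/
theorem coeff_two_formalXMulSq_mul_formalInvDiff : coeff 2 (W.formalXMulSq * W.formalInvDiff) = 0 := by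
  rw [coeff_mul, Finset.Nat.sum_antidiagonal_eq_sum_range_succ_mk, Finset.sum_range_succ, Finset.sum_range_succ,
    Finset.sum_range_succ, Finset.sum_range_zero, zero_add]
  simp only [Nat.sub_zero, Nat.reduceSub, Nat.sub_self, coeff_zero_eq_constantCoeff, constantCoeff_formalXMulSq,
    constantCoeff_formalInvDiff, coeff_one_formalXMulSq, coeff_one_formalInvDiff, coeff_two_formalXMulSq,
    coeff_two_formalInvDiff]
  ring

/-- **`g_W(0) = 0`**: the quasi-period integrand `g_W = (X·ω − 1)/z²` has no constant term (so
`η₀ = (a₃/2)z² + ⋯` starts in degree `2`). [cite: Katz1981CrystallineDieudonne, §5.1] -/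
theorem constantCoeff_formalQuasiPeriodIntegrand : constantCoeff W.formalQuasiPeriodIntegrand = 0 := by
  rw [← coeff_zero_eq_constantCoeff_apply, coeff_formalQuasiPeriodIntegrand, zero_add,
    coeff_two_formalXMulSq_mul_formalInvDiff]

end AnyRing

/-! ### Over a `ℚ`-algebra: `R_n(0) = 0` and `R_n' = g([n]X)·[n]' − n·g` -/

section RatAlgebra

variable {A : Type*} [CommRing A] [Algebra ℚ A] (V : WeierstrassCurve A)

/-- `R_n(0) = 0` (each `C₀([k]X, X)` has no constant term). [cite: Katz1981CrystallineDieudonne, §5.1] -/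
theorem constantCoeff_formalQuasiPeriodMulDefect (n : ℕ) : constantCoeff (V.formalQuasiPeriodMulDefect n) = 0 := by
  rw [formalQuasiPeriodMulDefect, map_sum]
  refine Finset.sum_eq_zero fun k _ => ?_
  exact MvPowerSeries.constantCoeff_subst_eq_zero (hasSubst_pair_X (V.constantCoeff_formalMul k))
    (fun i => by fin_cases i; exacts [V.constantCoeff_formalMul k, PowerSeries.constantCoeff_X])
    V.constantCoeff_formalQuasiPeriodCocycle

/-- **`R_n' = g_V([n]X)·[n]'(X) − n·g_V(X)`**: differentiate `R_n = η₀([n]X) − n·η₀(X)`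
(`formalQuasiPeriod_subst_formalMul`) with the chain rule and `η₀' = g_V`. [cite: Katz1981CrystallineDieudonne, §5.1] -/
theorem derivative_formalQuasiPeriodMulDefect (n : ℕ) :
    d⁄dX A (V.formalQuasiPeriodMulDefect n) =
      V.formalQuasiPeriodIntegrand.subst (V.formalMul n) * d⁄dX A (V.formalMul n) -
        (n : A⟦X⟧) * V.formalQuasiPeriodIntegrand := by
  have hs : HasSubst (V.formalMul n) := HasSubst.of_constantCoeff_zero' (V.constantCoeff_formalMul n)
  have hR : V.formalQuasiPeriodMulDefect n =
      V.formalQuasiPeriod.subst (V.formalMul n) - (n : A⟦X⟧) * V.formalQuasiPeriod := by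
    rw [V.formalQuasiPeriod_subst_formalMul n]; ring
  have hn : d⁄dX A ((n : A⟦X⟧) * V.formalQuasiPeriod) = (n : A⟦X⟧) * d⁄dX A V.formalQuasiPeriod := by
    rw [← nsmul_eq_mul, ← nsmul_eq_mul, map_nsmul]
  rw [hR, map_sub, derivative_subst A hs, derivative_formalQuasiPeriod, hn, derivative_formalQuasiPeriod]

end RatAlgebra

/-! ### Over `ℤ`: the integral derivative identity and the congruence modulo `p` -/

section Int

variable {p : ℕ} [Fact p.Prime] (W : WeierstrassCurve ℤ)

/-- `PowerSeries.map` along `ℤ ↪ ℚ` is injective. [folklore] -/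
private theorem powerSeries_map_int_injective :
    Function.Injective (PowerSeries.map (Int.castRingHom ℚ)) := fun f g h => by
  ext n
  have h' := congrArg (coeff n) h
  rw [coeff_map, coeff_map] at h'
  exact (Int.castRingHom ℚ).injective_int h'

/-- **The integral derivative identity `Rn' = g_W([p]X)·[p]'(X) − p·g_W(X)` in `ℤ⟦X⟧`** for any
integral lift `Rn` of `R_p(W ⊗ ℚ)` (both sides map to `derivative_formalQuasiPeriodMulDefect` in `ℚ⟦X⟧`;
`ℤ⟦X⟧ → ℚ⟦X⟧` is injective). [cite: Katz1981CrystallineDieudonne, §5.1] -/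
theorem derivative_eq_of_map_eq_formalQuasiPeriodMulDefect (n : ℕ) {Rn : ℤ⟦X⟧}
    (hRn : PowerSeries.map (Int.castRingHom ℚ) Rn = (W.map (Int.castRingHom ℚ)).formalQuasiPeriodMulDefect n) :
    d⁄dX ℤ Rn = W.formalQuasiPeriodIntegrand.subst (W.formalMul n) * d⁄dX ℤ (W.formalMul n) -
      (n : ℤ⟦X⟧) * W.formalQuasiPeriodIntegrand := by
  set φ := Int.castRingHom ℚ with hφ
  have hs : HasSubst (W.formalMul n) := HasSubst.of_constantCoeff_zero' (W.constantCoeff_formalMul n)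
  apply powerSeries_map_int_injective
  rw [← derivative_map, hRn, derivative_formalQuasiPeriodMulDefect, map_sub, map_mul, WeierstrassCurve.powerSeries_map_subst _ hs,
    map_formalQuasiPeriodIntegrand, ← derivative_map, map_formalMul, map_mul, map_natCast,
    map_formalQuasiPeriodIntegrand]

/-- `R_p(0) = 0` for an integral lift. [cite: Katz1981CrystallineDieudonne, §5.1] -/
theorem constantCoeff_eq_zero_of_map_eq_formalQuasiPeriodMulDefect (n : ℕ) {Rn : ℤ⟦X⟧}
    (hRn : PowerSeries.map (Int.castRingHom ℚ) Rn = (W.map (Int.castRingHom ℚ)).formalQuasiPeriodMulDefect n) :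
    constantCoeff Rn = 0 := by
  have h := congrArg constantCoeff hRn
  rw [← coeff_zero_eq_constantCoeff_apply, coeff_map, coeff_zero_eq_constantCoeff_apply,
    constantCoeff_formalQuasiPeriodMulDefect, eq_intCast, Int.cast_eq_zero] at h
  exact h

/-- **`[p]' ≡ 0 (mod p)`**: every coefficient of the derivative of the multiplication-by-`p` series is
divisible by `p` (`[Xʲ][p]' = (j+1)·[X^{j+1}][p]`, and `p ∣ [Xᵏ][p]` for `p ∤ k`, AEC IV.4.4).
[cite: SilvermanAEC2009, IV.4.4] -/
theorem map_zmod_derivative_formalMul_prime :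
    PowerSeries.map (Int.castRingHom (ZMod p)) (d⁄dX ℤ (W.formalMul p)) = 0 := by
  ext j
  rw [coeff_map, coeff_derivative, map_mul, map_zero]
  by_cases hj : p ∣ j + 1
  · have : (Int.castRingHom (ZMod p)) ((j : ℤ) + 1) = 0 := by
      rw [show ((j : ℤ) + 1) = ((j + 1 : ℕ) : ℤ) by push_cast; ring, map_natCast,
        ZMod.natCast_eq_zero_iff]
      exact hj
    rw [this, mul_zero]
  · rw [eq_intCast, (ZMod.intCast_zmod_eq_zero_iff_dvd _ p).2 (W.prime_dvd_coeff_formalMul_prime hj), zero_mul]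

/-- A series in `ℤ⟦X⟧` that vanishes modulo `p` is `p` times a series. [folklore] -/
private theorem exists_eq_natCast_mul_of_map_zmod_eq_zero {f : ℤ⟦X⟧}
    (hf : PowerSeries.map (Int.castRingHom (ZMod p)) f = 0) : ∃ D : ℤ⟦X⟧, f = (p : ℤ⟦X⟧) * D := by
  refine ⟨PowerSeries.mk fun n => coeff n f / p, ?_⟩
  ext n
  have hn : (p : ℤ) ∣ coeff n f := by
    have h := congrArg (coeff n) hf
    rw [coeff_map, map_zero, eq_intCast] at h
    exact (ZMod.intCast_zmod_eq_zero_iff_dvd _ p).1 h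
  rw [← map_natCast (C (R := ℤ)) p, coeff_C_mul, coeff_mk, Int.mul_ediv_cancel' hn]

/-- **`[p] ≡ 0 (mod p, X^p)`**: the reduction of `[p]_W` modulo `p` has order `≥ p`. [cite: SilvermanAEC2009, IV.4.4] -/
theorem le_order_map_zmod_formalMul_prime :
    (p : ℕ∞) ≤ (PowerSeries.map (Int.castRingHom (ZMod p)) (W.formalMul p)).order := by
  refine nat_le_order _ p fun i hi => ?_
  rw [coeff_map, eq_intCast, ZMod.intCast_zmod_eq_zero_iff_dvd]
  rcases Nat.eq_zero_or_pos i with rfl | hi0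
  · rw [coeff_zero_eq_constantCoeff, constantCoeff_formalMul]; exact dvd_zero _
  · exact W.prime_dvd_coeff_formalMul_prime fun h => absurd (Nat.le_of_dvd hi0 h) (not_le.2 hi)

/-- **`g_W([p]X) ≡ 0 (mod p, X^p)`**: `g_W(0) = 0` and `[p] ≡ 0 (mod p, X^p)`. [cite: Katz1981CrystallineDieudonne, §5.1] -/
theorem prime_dvd_coeff_formalQuasiPeriodIntegrand_subst_formalMul {i : ℕ} (hi : i < p) :
    (p : ℤ) ∣ coeff i (W.formalQuasiPeriodIntegrand.subst (W.formalMul p)) := by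
  set π := Int.castRingHom (ZMod p) with hπ
  have hs : HasSubst (W.formalMul p) := HasSubst.of_constantCoeff_zero' (W.constantCoeff_formalMul p)
  rw [← ZMod.intCast_zmod_eq_zero_iff_dvd, ← eq_intCast π, ← coeff_map, WeierstrassCurve.powerSeries_map_subst _ hs]
  apply coeff_of_lt_order
  have h0 : constantCoeff ((W.formalMul p).map π) = 0 := by
    rw [← coeff_zero_eq_constantCoeff_apply, coeff_map, coeff_zero_eq_constantCoeff_apply, constantCoeff_formalMul,
      map_zero]
  have hg0 : constantCoeff (W.formalQuasiPeriodIntegrand.map π) = 0 := by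
    rw [← coeff_zero_eq_constantCoeff_apply, coeff_map, coeff_zero_eq_constantCoeff_apply,
      constantCoeff_formalQuasiPeriodIntegrand, map_zero]
  calc (i : ℕ∞) < p := by exact_mod_cast hi
    _ ≤ ((W.formalMul p).map π).order := W.le_order_map_zmod_formalMul_prime
    _ ≤ _ := le_order_subst_right' h0 hg0

/-- **The η-Hasse congruence, low part: `p ∣ [Xʲ]R_p` for `j < p`** (any integral lift `Rn` of
`R_p(W ⊗ ℚ)`): `R_p' ≡ 0 (mod p)` and `[X⁰]R_p = 0`. [cite: Colmez1992PeriodesAbeliennes, §2]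
[cite: Katz1981CrystallineDieudonne, §5.1] -/
theorem prime_dvd_coeff_of_map_eq_formalQuasiPeriodMulDefect {Rn : ℤ⟦X⟧}
    (hRn : PowerSeries.map (Int.castRingHom ℚ) Rn = (W.map (Int.castRingHom ℚ)).formalQuasiPeriodMulDefect p)
    {j : ℕ} (hj : j < p) : (p : ℤ) ∣ coeff j Rn := by
  have hp : p.Prime := Fact.out
  rcases Nat.eq_zero_or_pos j with rfl | hj0
  · rw [coeff_zero_eq_constantCoeff, W.constantCoeff_eq_zero_of_map_eq_formalQuasiPeriodMulDefect p hRn]; exact dvd_zero _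
  obtain ⟨i, rfl⟩ := Nat.exists_eq_add_one_of_ne_zero hj0.ne'
  set π := Int.castRingHom (ZMod p) with hπ
  -- `R_p' ≡ 0 (mod p)`
  have hD : PowerSeries.map π (d⁄dX ℤ Rn) = 0 := by
    have hp0 : (p : (ZMod p)⟦X⟧) = 0 := by rw [← map_natCast (C (R := ZMod p)) p, ZMod.natCast_self, map_zero]
    rw [W.derivative_eq_of_map_eq_formalQuasiPeriodMulDefect p hRn, map_sub, map_mul,
      W.map_zmod_derivative_formalMul_prime, mul_zero, map_mul, map_natCast, hp0, zero_mul, sub_zero]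
  have h := congrArg (coeff i) hD
  rw [coeff_map, coeff_derivative, map_mul, map_zero, eq_intCast,
    show ((i : ℤ) + 1) = ((i + 1 : ℕ) : ℤ) by push_cast; ring, map_natCast] at h
  -- `i + 1` is a unit mod `p`
  have hu : ((i + 1 : ℕ) : ZMod p) ≠ 0 := by
    rw [Ne, ZMod.natCast_eq_zero_iff]
    exact fun hd => absurd (Nat.le_of_dvd (Nat.succ_pos i) hd) (not_le.2 hj)
  rw [← ZMod.intCast_zmod_eq_zero_iff_dvd]
  exact (mul_eq_zero.1 h).resolve_right hu

/-- **The η-Hasse congruence, top coefficient: `p ∣ [X^p]R_p + [X^{p−1}]g_W`**, i.e.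
`R_p ≡ −g_{p−1}·X^p (mod p, X^{p+1})` with `g_{p−1} = [z^{p+1}](X·ω)` the coefficient of `z^{p−1}dz` in the
differential of the second kind `x ω` (any integral lift `Rn` of `R_p(W ⊗ ℚ)`). From
`p·[X^p]R_p = [X^{p−1}](g_W([p])·[p]') − p·g_{p−1}` and `[X^{p−1}](g_W([p])·[p]') ∈ p²ℤ`.
[cite: Colmez1992PeriodesAbeliennes, §2] [cite: Katz1981CrystallineDieudonne, §5.1] -/
theorem prime_dvd_coeff_prime_add_coeff_formalQuasiPeriodIntegrand {Rn : ℤ⟦X⟧}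
    (hRn : PowerSeries.map (Int.castRingHom ℚ) Rn = (W.map (Int.castRingHom ℚ)).formalQuasiPeriodMulDefect p) :
    (p : ℤ) ∣ coeff p Rn + coeff (p - 1) W.formalQuasiPeriodIntegrand := by
  have hp : p.Prime := Fact.out
  obtain ⟨m, hm⟩ : ∃ m, p = m + 1 := ⟨p - 1, (Nat.succ_pred_eq_of_pos hp.pos).symm⟩
  have hpm : coeff p Rn = coeff (m + 1) Rn := by rw [hm]
  have hm1 : p - 1 = m := by omega
  rw [hpm, hm1]
  -- `[p]' = p·D`
  obtain ⟨D, hD⟩ := exists_eq_natCast_mul_of_map_zmod_eq_zero (W.map_zmod_derivative_formalMul_prime (p := p))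
  -- the coefficient of `X^{p-1}` of the integral derivative identity
  have h := congrArg (coeff m) (W.derivative_eq_of_map_eq_formalQuasiPeriodMulDefect p hRn)
  rw [coeff_derivative, map_sub, hD, mul_left_comm, ← map_natCast (C (R := ℤ)) p, coeff_C_mul, coeff_C_mul,
    show ((m : ℤ) + 1) = (p : ℤ) by rw [hm]; push_cast; ring] at h
  -- `p ∣ [X^{p-1}](g_W([p]) · D)`
  have hdvd : (p : ℤ) ∣ coeff m (W.formalQuasiPeriodIntegrand.subst (W.formalMul p) * D) := by
    rw [coeff_mul]
    refine Finset.dvd_sum fun x hx => dvd_mul_of_dvd_left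
      (W.prime_dvd_coeff_formalQuasiPeriodIntegrand_subst_formalMul ?_) _
    have := Finset.HasAntidiagonal.mem_antidiagonal.1 hx
    omega
  obtain ⟨c, hc⟩ := hdvd
  rw [hc] at h
  have hpz : (p : ℤ) ≠ 0 := by exact_mod_cast hp.ne_zero
  have key : coeff (m + 1) Rn = (p : ℤ) * c - coeff m W.formalQuasiPeriodIntegrand := by
    apply mul_left_cancel₀ hpz
    linear_combination h
  rw [key]
  exact ⟨c, by ring⟩

end Int

end WeierstrassCurve

end
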